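import Summits.ResolutionOfSingularities.ResolutionOfSingularities.Theorems.HilbertSamuelEliminationSigmaMaxModificationsCorridor3SigmaTameLowSncBranchTransform
import Summits.ResolutionOfSingularities.ResolutionOfSingularities.Theorems.HilbertSamuelEliminationSigmaMaxModificationsCorridor3SigmaTameLowSncTransform
import Literature.AlgebraicGeometry.Resolution.QuadraticTransformDelta
import Mathlib.RingTheory.KrullDimension.Regular
import HarnessLib

/-!
# [OURS · L1 W4.2] TAME-LOW row T-L4 «SNC PHASE, lineage-local» — part 4c (singular-branch half): THE STRICT TRANSFORM OF A BRANCH AT A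
# POINT OF THE BLOW-UP IS A QUADRATIC TRANSFORM OF THE BRANCH; hence its `δ`-invariant drops (tree: `IsQuadraticTransform.curveDelta_lt`),
# and a branch whose local ring is regular is a regular parameter
# (cell res-hironaka, LADDER-RESOLUTION rung L; slot W4.2, crux chain w42 `SigmaMaxModificationsCorridor3` stmt-ResolutionOfSingularities-19249 /
# crux `SigmaMaxModifications` stmt-…-18506; res-L1-w42-plan-1 RULING v3.14-48 (PD)(iv)/(PF) row T-L4 → res-L1-w42-stub-4 (gen 7);
# `--supports stmt-ResolutionOfSingularities-19249 --as helper`; consumer: part 4d (per-branch lineage: eventually unit or regular),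
# then part 3's entry hypothesis)

HONEST FRAMING.  OURS bookkeeping for the TAME-LOW tier (RULING v3.14-48 (PD)(iv)): Herrmann–Ikeda–Orbanz Thm. (30.2) (b) in the
`Subring K` currency, feeding the tree's PROVED `δ`-drop (Kollár 2007 §1.4 / Krull 1930; `QuadraticTransformDelta.lean`; the two
ℕ-valued wrappers of §0 are universe-polymorphic copies of res-type-062's W4.1 lemmas `…SwitchingDichotomy.CurveLineage.curveGerm_quadraticTransform`
/ `toNat_curveDelta_lt_of_quadraticTransform`, which are stated for `K : Type` only). Nothing
here is a statement of H. Hironaka's manuscript [Hironaka2017] (CANDIDATE, never a premise) nor of Cossart–Jannsen–Saito; no named fact;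
def-free; every theorem PROVED. AI-written; weaker than expert review.

SETTING (as in part 4b).  `R ⊆ R₁ ⊆ K`, `R` two-dimensional regular local, `𝔪_R = (x, y)`, `R₁` a quadratic transform of `R` with
`R[𝔪/x] ⊆ R₁`; `θ : R → L` a point of the branch (`ker θ = (f)`, `f ∈ 𝔪ᵐ ∖ 𝔪ᵐ⁺¹`, `θ x ≠ 0`); the strict transform `f₁ = f/xᵐ`
lies in `𝔪_{R₁}`; `ψ = branchLift … : R₁ → L` (part 4b). Write `D = θ(R)`, `S = ψ(R₁)` (local subrings of `L`).

* `mem_maximalIdeal_range_iff` — `θ r ∈ 𝔪_D ↔ r ∈ 𝔪_R`; `chartLift_mem_blowupRing` — `chartLift θ (R[y/x]) ⊆ D[𝔪_D/θ x]`.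
* **`isQuadraticTransform_range_branchLift`** — **`S` is a quadratic transform of `D`** (Herrmann–Ikeda–Orbanz (30.2) (b)): `S` is local,
  contains `D[𝔪_D/θ x]`, consists of fractions `a/b` over it with `b⁻¹ ∈ S`, and dominates `D` (`ker ψ = (f₁) ⊆ 𝔪_{R₁}`).
* **`toNat_curveDelta_range_branchLift_lt`** — if `D` is a local ring OF `L` (`Frac D = L`, e.g. `L = Frac(R/(f))`) with module-finite
  normalisation and is NOT regular, then `δ(S) < δ(D)`; `curveGerm_range_branchLift` — the class (local ring of `L`, Noetherian,
  dimension one, finite normalisation) passes from `D` to `S`.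
* **`not_mem_sq_of_isDiscreteValuationRing_range`** — if `D = θ(R)` is a discrete valuation ring then `f ∉ 𝔪_R²`: a branch with regular
  local ring is a REGULAR PARAMETER (`𝔪_R = (π, f)` for a lift `π` of a uniformiser; part 1a `prime_and_not_dvd_of_span_pair`).

References: M. Herrmann, S. Ikeda, U. Orbanz (1988), Thm. (30.2) [HerrmannIkedaOrbanz1988]; J. Kollár, *Lectures on Resolution of
Singularities* (2007), §1.4, Thm. 1.101 [Kollar2007].
-/

noncomputable section

set_option linter.dupNamespace false -- mandated namespace of this single-conjunct summit

open IsLocalRing Polynomial Literature.AlgebraicGeometry.Resolution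

namespace Summit.ResolutionOfSingularities.ResolutionOfSingularities.Theorems.SigmaMaxModificationsCorridor3.TameLowSnc

universe u v

variable {K : Type u} [Field K]

/-! ## §0 Universe-polymorphic copies of the W4.1 `δ` wrappers (res-type-062, `…SwitchingDichotomy.CurveLineage`, `K : Type` there) -/

section Germ

variable {L : Type v} [Field L]

/-- The class «one-dimensional Noetherian local ring OF `L` with module-finite normalisation» is stable under quadratic transforms
(Krull–Akizuki; copy of `CurveLineage.curveGerm_quadraticTransform` at universe `v`). [cite: Kollar2007, §1.4] -/
theorem curveGerm_quadraticTransform' {D S : Subring L} (hof : IsLocalRingOf D) (hN : IsNoetherianRing D)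
    (hdim : ringKrullDim D = 1) (hfin : Module.Finite D (integralClosure D L)) (h : IsQuadraticTransform D S) :
    IsLocalRingOf S ∧ IsNoetherianRing S ∧ ringKrullDim S = 1 ∧ Module.Finite S (integralClosure S L) := by
  -- adapted from Summits/…/Theorems/FrobeniusClosingSteerCurveLineageRegular.lean (res-type-062), universe-generalised
  haveI : IsLocalRing D := hof.1
  haveI := hN
  haveI := hfin
  haveI : IsFractionRing D L := isFractionRing_of_isLocalRingOf_le hof.2 le_rfl
  have hD : ¬ IsField D := (ringKrullDim_eq_one_iff_of_isLocalRing_isDomain.mp hdim).1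
  haveI : IsDedekindDomain (integralClosure D L) := isDedekindDomain_integralClosure_of_module_finite D L hdim.le
  refine ⟨⟨h.isLocalRing, fun z => ?_⟩, h.isNoetherianRing hof hD hdim, h.ringKrullDim_eq_one hof hD hdim,
    h.module_finite_integralClosure hof⟩
  obtain ⟨a, ha, b, hb, hb0, rfl⟩ := hof.2 z
  exact ⟨a, h.le' ha, b, h.le' hb, hb0, rfl⟩

/-- `δ < ∞` for a curve germ. [cite: Kollar2007, §1.4] -/
theorem coe_toNat_curveDelta' {D : Subring L} (hof : IsLocalRingOf D) (hN : IsNoetherianRing D)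
    (hdim : ringKrullDim D = 1) (hfin : Module.Finite D (integralClosure D L)) :
    ((curveDelta D L).toNat : ℕ∞) = curveDelta D L := by
  haveI : IsLocalRing D := hof.1
  haveI := hN
  haveI := hfin
  haveI : IsFractionRing D L := isFractionRing_of_isLocalRingOf_le hof.2 le_rfl
  exact ENat.coe_toNat (curveDelta_ne_top L hdim)

/-- **`δ` drops strictly under a quadratic transform of a NON-regular curve germ** (as natural numbers; copy of
`CurveLineage.toNat_curveDelta_lt_of_quadraticTransform` at universe `v`). [cite: Kollar2007, §1.4, Thm. 1.101] -/
theorem toNat_curveDelta_lt_of_quadraticTransform' {D S : Subring L} (hof : IsLocalRingOf D)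
    (hN : IsNoetherianRing D) (hdim : ringKrullDim D = 1) (hfin : Module.Finite D (integralClosure D L))
    (hreg : ¬ IsDiscreteValuationRing D) (h : IsQuadraticTransform D S) :
    (curveDelta S L).toNat < (curveDelta D L).toNat := by
  -- adapted from Summits/…/Theorems/FrobeniusClosingSteerCurveLineageRegular.lean (res-type-062), universe-generalised
  haveI : IsLocalRing D := hof.1
  haveI := hN
  haveI := hfin
  haveI : IsFractionRing D L := isFractionRing_of_isLocalRingOf_le hof.2 le_rfl
  have hD : ¬ IsField D := (ringKrullDim_eq_one_iff_of_isLocalRing_isDomain.mp hdim).1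
  haveI : IsDedekindDomain (integralClosure D L) := isDedekindDomain_integralClosure_of_module_finite D L hdim.le
  haveI : IsFractionRing (integralClosure D L) L := isFractionRing_integralClosure D L
  haveI : IsFractionRing S L := isFractionRing_of_isLocalRingOf_le hof.2 h.le'
  have hlt := IsQuadraticTransform.curveDelta_lt hof hD hdim hreg h
  obtain ⟨hofS, hNS, hdimS, hfinS⟩ := curveGerm_quadraticTransform' hof hN hdim hfin h
  have h1 := coe_toNat_curveDelta' hof hN hdim hfin
  have h2 := coe_toNat_curveDelta' hofS hNS hdimS hfinS
  rw [← h1, ← h2] at hlt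
  exact_mod_cast hlt

end Germ

/-! ## §1 The local ring `θ(R)` of the branch -/

section Range

variable {R : Subring K} [IsRegularLocalRing R] {L : Type v} [Field L]

/-- `θ(R)` is a local ring (surjective image of the local ring `R`, non-trivial inside the field `L`). [OURS · proved] -/
theorem isLocalRing_range (θ : R →+* L) : IsLocalRing θ.range :=
  IsLocalRing.of_surjective' θ.rangeRestrict θ.rangeRestrict_surjective

/-- **`θ r ∈ 𝔪_{θ(R)} ↔ r ∈ 𝔪_R`** (`ker θ = (f) ⊆ 𝔪_R`). [OURS · proved] -/
theorem mem_maximalIdeal_range_iff (θ : R →+* L) {f : R} (hker : RingHom.ker θ = Ideal.span {f}) (hfm : f ∈ maximalIdeal R)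
    (r : R) : haveI := isLocalRing_range θ
      θ.rangeRestrict r ∈ maximalIdeal θ.range ↔ r ∈ maximalIdeal R := by
  haveI := isLocalRing_range θ
  rw [mem_maximalIdeal, mem_maximalIdeal, mem_nonunits_iff, mem_nonunits_iff, isUnit_rangeRestrict_iff θ hker hfm]

/-- Every element of `𝔪_{θ(R)}` is `θ r` with `r ∈ 𝔪_R`. [OURS · proved] -/
theorem exists_eq_of_mem_maximalIdeal_range (θ : R →+* L) {f : R} (hker : RingHom.ker θ = Ideal.span {f})
    (hfm : f ∈ maximalIdeal R) {d : θ.range} (hd : haveI := isLocalRing_range θ; d ∈ maximalIdeal θ.range) :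
    ∃ r ∈ maximalIdeal R, (d : L) = θ r := by
  obtain ⟨r, hr⟩ := θ.rangeRestrict_surjective d
  refine ⟨r, (mem_maximalIdeal_range_iff θ hker hfm r).mp (hr ▸ hd), ?_⟩
  rw [← hr]; rfl

/-- `𝔪_{θ(R)} = (θ x, θ y)` for `𝔪_R = (x, y)`. [OURS · proved] -/
theorem maximalIdeal_range_eq_span_pair (θ : R →+* L) {f : R} (hker : RingHom.ker θ = Ideal.span {f})
    (hfm : f ∈ maximalIdeal R) {x y : R} (hm : maximalIdeal R = Ideal.span {x, y}) :
    haveI := isLocalRing_range θ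
    maximalIdeal θ.range = Ideal.span {θ.rangeRestrict x, θ.rangeRestrict y} := by
  haveI := isLocalRing_range θ
  have hx : x ∈ maximalIdeal R := hm ▸ Ideal.subset_span (by simp)
  have hy : y ∈ maximalIdeal R := hm ▸ Ideal.subset_span (by simp)
  apply le_antisymm
  · intro d hd
    obtain ⟨r, hr, hdr⟩ := exists_eq_of_mem_maximalIdeal_range θ hker hfm hd
    rw [hm, Ideal.mem_span_pair] at hr
    obtain ⟨a, b, rfl⟩ := hr
    have e : d = θ.rangeRestrict a * θ.rangeRestrict x + θ.rangeRestrict b * θ.rangeRestrict y := Subtype.ext (by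
      rw [hdr]; simp only [map_add, map_mul, Subring.coe_add, Subring.coe_mul, RingHom.coe_rangeRestrict])
    rw [e]
    exact Ideal.add_mem _ (Ideal.mul_mem_left _ _ (Ideal.subset_span (by simp)))
      (Ideal.mul_mem_left _ _ (Ideal.subset_span (by simp)))
  · exact span_pair_le_iff.mpr ⟨(mem_maximalIdeal_range_iff θ hker hfm x).mpr hx, (mem_maximalIdeal_range_iff θ hker hfm y).mpr hy⟩

/-- **A branch with regular local ring is a regular parameter**: if `θ(R) ≅ R/(f)` is a discrete valuation ring (`R` two-dimensional
regular, `ker θ = (f)`, `f ∈ 𝔪_R`) then `f ∉ 𝔪_R²` — for a lift `π` of a uniformiser, `𝔪_R = (π, f)`. [OURS · proved] -/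
theorem not_mem_sq_of_isDiscreteValuationRing_range (hdim : ringKrullDim R = 2) (θ : R →+* L) {f : R}
    (hker : RingHom.ker θ = Ideal.span {f}) (hfm : f ∈ maximalIdeal R)
    (hDVR : haveI := isLocalRing_range θ; IsDiscreteValuationRing θ.range) : f ∉ maximalIdeal R ^ 2 := by
  haveI := isLocalRing_range θ
  haveI := hDVR
  obtain ⟨ϖ, hϖ⟩ := IsDiscreteValuationRing.exists_irreducible θ.range
  have hmax : maximalIdeal θ.range = Ideal.span {ϖ} := hϖ.maximalIdeal_eq
  obtain ⟨π, hπ⟩ := θ.rangeRestrict_surjective ϖ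
  have hπm : π ∈ maximalIdeal R := by
    rw [← mem_maximalIdeal_range_iff θ hker hfm π, hπ, hmax]; exact Ideal.mem_span_singleton_self _
  -- `𝔪_R = (π, f)`
  have hm : maximalIdeal R = Ideal.span {π, f} := by
    apply le_antisymm _ (span_pair_le_iff.mpr ⟨hπm, hfm⟩)
    intro r hr
    have hθr : θ.rangeRestrict r ∈ maximalIdeal θ.range := (mem_maximalIdeal_range_iff θ hker hfm r).mpr hr
    rw [hmax, Ideal.mem_span_singleton', ← hπ] at hθr
    obtain ⟨c, hc⟩ := hθr
    obtain ⟨c', hc'⟩ := θ.rangeRestrict_surjective c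
    -- `θ (c' π) = θ r`, so `r - c' π ∈ (f)`
    have hdiff : r - c' * π ∈ RingHom.ker θ := by
      rw [RingHom.mem_ker, map_sub, map_mul, sub_eq_zero]
      have := congrArg (fun t : θ.range => (t : L)) hc
      simp only [Subring.coe_mul, RingHom.coe_rangeRestrict] at this
      rw [← this, ← hc']; rfl
    rw [hker, Ideal.mem_span_singleton'] at hdiff
    obtain ⟨e, he⟩ := hdiff
    rw [Ideal.mem_span_pair]
    exact ⟨c', e, by linear_combination he⟩
  exact (prime_and_not_dvd_of_span_pair hdim hm).2.2.1

/-- `dim θ(R) = dim R/(f) = 1` for `f ∈ 𝔪_R ∖ 0` (`dim R/(f) + 1 = dim R` for the non-zero-divisor `f`). [OURS · proved] -/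
theorem ringKrullDim_range_eq_one (hdim : ringKrullDim R = 2) (θ : R →+* L) {f : R} (hker : RingHom.ker θ = Ideal.span {f})
    (hfm : f ∈ maximalIdeal R) (hf0 : f ≠ 0) : ringKrullDim θ.range = 1 := by
  have e := ringKrullDim_quotient_span_singleton_succ_eq_ringKrullDim_of_mem_nonZeroDivisors
    (mem_nonZeroDivisors_of_ne_zero hf0) hfm
  rw [hdim] at e
  have e2 : ringKrullDim θ.range = ringKrullDim (R ⧸ Ideal.span {f}) :=
    ringKrullDim_eq_of_ringEquiv ((RingHom.quotientKerEquivRange θ).symm.trans (Ideal.quotEquivOfEq hker))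
  rw [e2]
  -- solve `d + 1 = 2` in `WithBot ℕ∞`
  generalize ringKrullDim (R ⧸ Ideal.span {f}) = d at e ⊢
  induction d using WithBot.recBotCoe with
  | bot => exact absurd e (by simp)
  | coe d =>
    have e' : d + 1 = 2 := by
      have h : ((d + 1 : ℕ∞) : WithBot ℕ∞) = ((2 : ℕ∞) : WithBot ℕ∞) := by
        rw [WithBot.coe_add]; exact e
      exact WithBot.coe_injective h
    induction d using ENat.recTopCoe with
    | top => exact absurd e' (by simp)
    | coe n =>
      have h3 : n + 1 = 2 := by exact_mod_cast e'
      have h4 : n = 1 := by omega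
      subst h4; rfl

end Range

/-! ## §2 The strict transform of the branch is a quadratic transform of the branch -/

section Bridge

variable {R R₁ : Subring K} [IsRegularLocalRing R] [IsLocalRing R₁] {x y : R} {L : Type v} [Field L]
  (hdim : ringKrullDim R = 2) (hm : maximalIdeal R = Ideal.span {x, y}) (hq : IsQuadraticTransform R R₁)
  (hT : blowupRing R (x : K) ≤ R₁) (θ : R →+* L) (hθx : θ x ≠ 0) {f : R} (hker : RingHom.ker θ = Ideal.span {f}) {m : ℕ}
  (hf : f ∈ maximalIdeal R ^ m) (hf' : f ∉ maximalIdeal R ^ (m + 1)) (hfm : f ∈ maximalIdeal R)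
  (hf₁ : (⟨_, chartAdjoin_le hm hT (div_pow_mem_chartAdjoin hm
    (fun h => fst_not_mem_sq hdim hm (h ▸ Ideal.zero_mem _)) hf)⟩ : R₁) ∈ maximalIdeal R₁)

include hm hker hfm in
/-- `chartLift θ` maps `R[y/x]` into the blow-up ring `D[𝔪_D/θ x]` of the branch (`P(y/x) ↦ P^θ(θ y/θ x)`). [OURS · proved] -/
theorem chartLift_mem_blowupRing (hx0 : x ≠ 0) (a : chartAdjoin (K := K) x y) :
    haveI := isLocalRing_range θ
    chartLift (K := K) hx0 θ hθx a ∈ blowupRing θ.range (θ x) := by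
  haveI := isLocalRing_range θ
  have hy : y ∈ maximalIdeal R := hm ▸ Ideal.subset_span (by simp)
  obtain ⟨P, hP⟩ := aevalChart_surjective (K := K) x y a
  rw [← hP, chartLift_aevalChart, eval₂_eq_sum_range]
  refine Subring.sum_mem _ fun i _ => Subring.mul_mem _ (le_blowupRing _ _ ⟨P.coeff i, rfl⟩) (Subring.pow_mem _ ?_ _)
  have h := div_mem_blowupRing (R := θ.range) (θ x) (y := θ.rangeRestrict y)
    ((mem_maximalIdeal_range_iff θ hker hfm y).mpr hy)
  exact h

include hdim hm hq hT hθx hker hf hf' hfm hf₁ in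
/-- **THE STRICT TRANSFORM IS A QUADRATIC TRANSFORM OF THE BRANCH** (Herrmann–Ikeda–Orbanz Thm. (30.2) (b)): with `ψ = branchLift …`,
`ψ(R₁)` is a quadratic transform of `θ(R)` inside `L`, in the chart of `θ x`. [OURS · proved; Herrmann–Ikeda–Orbanz (30.2) (b)] -/
theorem isQuadraticTransform_range_branchLift :
    IsQuadraticTransform θ.range (branchLift hdim hm hq hT θ hθx hker hf hf' hf₁).range := by
  haveI hDloc := isLocalRing_range θ
  set ψ := branchLift hdim hm hq hT θ hθx hker hf hf' hf₁ with hψdef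
  haveI hSloc : IsLocalRing ψ.range := IsLocalRing.of_surjective' ψ.rangeRestrict ψ.rangeRestrict_surjective
  have hx0 : x ≠ 0 := fun h => fst_not_mem_sq hdim hm (h ▸ Ideal.zero_mem _)
  have hx0K : ((x : R) : K) ≠ 0 := fun e => hx0 (Subtype.ext e)
  have hxm : x ∈ maximalIdeal R := hm ▸ Ideal.subset_span (by simp)
  have hdom := hq.dominates
  have hRle : R ≤ R₁ := hdom.1
  have hAle := chartAdjoin_le (K := K) hm hT
  set Q : Ideal (chartAdjoin (K := K) x y) := (maximalIdeal R₁).comap (Subring.inclusion hAle) with hQ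
  have hR₁ : R₁ = (LocalSubring.ofPrime _ Q).toSubring :=
    hq.eq_ofPrime_of_le hxm hx0 (blowupRing_eq_adjoin (K := K) hm).le hAle
  -- `ψ r = θ r`, so `D ≤ S`
  have hψR : ∀ r : R, ψ (Subring.inclusion hRle r) = θ r := branchLift_inclusion hdim hm hq hT θ hθx hker hf hf' hf₁
  have hDS : θ.range ≤ ψ.range := by
    rintro _ ⟨r, rfl⟩; exact ⟨Subring.inclusion hRle r, hψR r⟩
  -- `ψ (r/x) = θ r / θ x` for `r ∈ 𝔪_R`
  have hψdiv : ∀ (r : R) (hr : r ∈ maximalIdeal R), ψ ⟨_, div_mem_of_mem_maximalIdeal hT hr⟩ = θ r / θ x := by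
    intro r hr
    rw [eq_div_iff hθx, ← hψR r, ← hψR x, ← map_mul]
    congr 1
    apply Subtype.ext
    change ((r : R) : K) / x * (x : K) = (r : K)
    rw [div_mul_cancel₀ _ hx0K]
  have hBle : blowupRing θ.range (θ x) ≤ ψ.range := by
    refine Subring.closure_le.mpr ?_
    rintro z (hz | ⟨d, hd, rfl⟩)
    · exact hDS hz
    · obtain ⟨r, hr, hdr⟩ := exists_eq_of_mem_maximalIdeal_range θ hker hfm hd
      change (d : L) / θ x ∈ ψ.range
      rw [hdr, ← hψdiv r hr]
      exact ⟨_, rfl⟩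
  refine ⟨hDloc, ⟨θ x, ⟨x, rfl⟩⟩, (mem_maximalIdeal_range_iff θ hker hfm x).mpr hxm,
    fun h => hθx (congrArg Subtype.val h), hSloc, hBle, ?_, ⟨hDS, ?_⟩⟩
  · -- fractions: `z = ψ w`, `w = a/s`, so `z = chartLift a / chartLift s`
    rintro _ ⟨w, rfl⟩
    obtain ⟨a, s, hs, hwas⟩ := mem_ofPrime_iff.mp (hR₁.le w.2)
    have hs0 : ((s : chartAdjoin (K := K) x y) : K) ≠ 0 := coe_ne_zero_of_not_mem hs
    have hws : (w : K) * (s : K) = (a : K) := by rw [hwas, div_mul_cancel₀ _ hs0]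
    have hmul := branchLift_mul_eq hdim hm hq hT θ hθx hker hf hf' hf₁ hws
    have hsu : chartLift (K := K) hx0 θ hθx s ≠ 0 :=
      (isUnit_chartLift_of_not_mem hdim hm hT θ hθx hker hf hf' hf₁ ⟨s, hs⟩).ne_zero
    refine ⟨_, chartLift_mem_blowupRing hm θ hθx hker hfm hx0 a, _, chartLift_mem_blowupRing hm θ hθx hker hfm hx0 s, ?_, ?_⟩
    · -- `(chartLift s)⁻¹ = ψ (s⁻¹) ∈ S`, `s` being a unit of `R₁`
      have hsR₁ : ((s : chartAdjoin (K := K) x y) : K) ∈ R₁ := hAle s.2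
      have hsunit : IsUnit (⟨(s : K), hsR₁⟩ : R₁) := by
        by_contra hns
        exact hs ((mem_maximalIdeal _).mpr hns)
      obtain ⟨v, hv⟩ := hsunit
      have hψs : ψ (v : R₁) = chartLift (K := K) hx0 θ hθx s := by
        rw [hv]; exact branchLift_of_mem_chart hdim hm hq hT θ hθx hker hf hf' hf₁ s
      refine ⟨↑v⁻¹, ?_⟩
      rw [← hψs, ← map_units_inv]
    · rw [eq_div_iff hsu, hmul]
  · -- domination: `d = θ r` with `d⁻¹ = ψ w ∈ S` forces `r` to be a unit of `R`
    rintro _ ⟨r, rfl⟩ ⟨w, hw⟩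
    by_cases hr0 : θ r = 0
    · rw [hr0, inv_zero]; exact θ.range.zero_mem
    have h1 : ψ (Subring.inclusion hRle r * w) = 1 := by rw [map_mul, hψR, hw, mul_inv_cancel₀ hr0]
    have h2 : Subring.inclusion hRle r * w - 1 ∈ RingHom.ker ψ := by
      rw [RingHom.mem_ker, map_sub, h1, map_one, sub_self]
    rw [hψdef, ker_branchLift, Ideal.mem_span_singleton'] at h2
    obtain ⟨c, hc⟩ := h2
    have h3 : Subring.inclusion hRle r * w - 1 ∈ maximalIdeal R₁ := by rw [← hc]; exact Ideal.mul_mem_left _ _ hf₁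
    have h4 : IsUnit (Subring.inclusion hRle r * w) := by
      by_contra hnu
      have := Ideal.sub_mem _ ((mem_maximalIdeal _).mpr hnu) h3
      rw [sub_sub_cancel] at this
      exact (maximalIdeal.isMaximal R₁).ne_top (Ideal.eq_top_of_isUnit_mem _ this isUnit_one)
    have h5 : IsUnit r := by
      have h6 : Subring.inclusion hRle r ∉ maximalIdeal R₁ :=
        fun h => (mem_maximalIdeal _).mp h (isUnit_of_mul_isUnit_left h4)
      rw [incl_mem_maximalIdeal_iff hdom] at h6
      exact not_not.mp fun h => h6 ((mem_maximalIdeal _).mpr h)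
    obtain ⟨v, hv⟩ := h5
    refine ⟨(↑v⁻¹ : R), ?_⟩
    rw [← hv, ← map_units_inv]

include hdim hm hq hT hθx hker hf hf' hfm hf₁ in
/-- **`δ` DROPS UNDER THE STRICT TRANSFORM OF A SINGULAR BRANCH**: if `D = θ(R)` is a local ring of `L` (`Frac D = L`) with
module-finite normalisation and is not regular, then `δ(ψ(R₁)) < δ(D)` (as natural numbers). [OURS · proved; Kollár 2007 §1.4 via the
tree's `IsQuadraticTransform.curveDelta_lt`] -/
theorem toNat_curveDelta_range_branchLift_lt (hof : IsLocalRingOf θ.range)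
    (hfin : Module.Finite θ.range (integralClosure θ.range L))
    (hsing : haveI := isLocalRing_range θ; ¬ IsDiscreteValuationRing θ.range) :
    (curveDelta (branchLift hdim hm hq hT θ hθx hker hf hf' hf₁).range L).toNat < (curveDelta θ.range L).toNat := by
  have hD : IsNoetherianRing θ.range := inferInstance
  have hf0 : f ≠ 0 := fun h => hf' (h ▸ Ideal.zero_mem _)
  have hdimD : ringKrullDim θ.range = 1 := ringKrullDim_range_eq_one hdim θ hker hfm hf0
  exact toNat_curveDelta_lt_of_quadraticTransform' hof hD hdimD hfin hsing
    (isQuadraticTransform_range_branchLift hdim hm hq hT θ hθx hker hf hf' hfm hf₁)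

include hdim hm hq hT hθx hker hf hf' hfm hf₁ in
/-- **The class persists**: if `D = θ(R)` is a local ring of `L`, (Noetherian, one-dimensional — automatic) with module-finite
normalisation, then so is `ψ(R₁)`. [OURS · proved; Krull–Akizuki via the tree] -/
theorem curveGerm_range_branchLift (hof : IsLocalRingOf θ.range) (hfin : Module.Finite θ.range (integralClosure θ.range L)) :
    IsLocalRingOf (branchLift hdim hm hq hT θ hθx hker hf hf' hf₁).range ∧
      IsNoetherianRing (branchLift hdim hm hq hT θ hθx hker hf hf' hf₁).range ∧
      ringKrullDim (branchLift hdim hm hq hT θ hθx hker hf hf' hf₁).range = 1 ∧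
      Module.Finite (branchLift hdim hm hq hT θ hθx hker hf hf' hf₁).range
        (integralClosure (branchLift hdim hm hq hT θ hθx hker hf hf' hf₁).range L) := by
  have hD : IsNoetherianRing θ.range := inferInstance
  have hf0 : f ≠ 0 := fun h => hf' (h ▸ Ideal.zero_mem _)
  have hdimD : ringKrullDim θ.range = 1 := ringKrullDim_range_eq_one hdim θ hker hfm hf0
  exact curveGerm_quadraticTransform' hof hD hdimD hfin
    (isQuadraticTransform_range_branchLift hdim hm hq hT θ hθx hker hf hf' hfm hf₁)

end Bridge

end Summit.ResolutionOfSingularities.ResolutionOfSingularities.Theorems.SigmaMaxModificationsCorridor3.TameLowSnc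

end
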